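import Summits.CriticalPhenomena.CardyFormulaZ2.Theorems.CardyMagicRigidityNestingRigidityNeckRingIndexCellsT
import Summits.CriticalPhenomena.CardyFormulaZ2.Theorems.CardyMagicRigidityNestingRigidityNeckZ2SkeletonCells
import HarnessLib

/-!
# Crux `NestingRigidity`, line `pinch-resampling` (v4), stub S11: cell skeletons of the hexagonal ring and the isolation of hierarchy nodes

Crux `Summit.CriticalPhenomena.CardyFormulaZ2.Theses.CardyMagicRigidity.NestingRigidity` (stmt-CriticalPhenomena-4835),
line `pinch-resampling` v4, stub S11 `stub_neckHookupCoarseT : NeckHookupCoarseT`.  Worker W6c, wave 6: the site-`𝕋` twin of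
`…NeckZ2SkeletonCells` (worker W6a).  The cell skeleton `NeckCoarseZ2.CellSkeleton Nc` (cut, sorted rotated cells, wrap
property), its gap sequence `gapZ`, outer gaps `gapOutZ` and the bridge to `…GapHierarchy` are lattice-free and REUSED from
the `ℤ²` file; here are the two lattice-specific parts for the hexagonal ring `{|·|_𝕋 = R}` (`6R` cells of fixed phase,
`…NeckRingIndexCellsT`):

* §1 **Isolation of nodes** (`CellSkeleton.triNorm_sub_center_lt`, `CellSkeleton.le_two_mul_triNorm_sub_center`, registered
  anchor `triCellSkeleton_isolation`): for an index interval `[i, j]` with centre `triIdxPt (t i)`, a ring point of rotated cell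
  `t m`, `i ≤ m ≤ j`, is at `𝕋`-distance `< (t j - t i + 1) ℓ`; if `m < i` or `j < m` and `[i, j]` is not the root, it is at
  `𝕋`-distance `≥ (ℓ G - 2ℓ + 1)/2`, `G = gapOutZ i j` — the hypotheses `hin`, `hout` of the node certificate
  `TNecklace.exists_node_crossings` (`…NeckNecklaceCertificatesT`).
* §2 `CellSkeleton.exists_triCellSkeleton`: every nonempty finite set of ring offsets has a cell skeleton listing exactly its
  rotated cells (good cut `NeckCoarseZ2.exists_good_cut` + sorting, verbatim as on `ℤ²`).
-/

noncomputable section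

namespace Summit.CriticalPhenomena.CardyFormulaZ2.Cruxes.NestingRigidity.PinchResampling

open Literature.Probability.Percolation Literature.Probability.LatticeModels
open Finset

namespace NeckCoarseZ2

namespace CellSkeleton

variable {Nc : ℤ} (S : CellSkeleton Nc) (Groot : ℤ)

/-! ## §1 Isolation of nodes on the hexagonal ring -/

variable {R ℓ : ℤ}

/-- **Inner isolation**: a ring point whose rotated cell is `t m`, `i ≤ m ≤ j < n`, is at `𝕋`-distance
`< (t j - t i + 1) ℓ` from the centre `idxPt (t i)` (`(Nc - 1) ℓ < 6R ≤ Nc ℓ`). -/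
theorem triNorm_sub_center_lt (hℓ : 0 < ℓ) (hR : 1 ≤ R) (hNc : 6 * R ≤ Nc * ℓ) (hNc' : (Nc - 1) * ℓ < 6 * R)
    {d : Site 2} (hd : triNorm d = R) {i j m : ℕ} (him : i ≤ m) (hmj : m ≤ j) (hj : j < S.n)
    (hcell : rotIdx Nc S.a₀ (NeckCoarse.triCellIdx R ℓ d) = S.t m) :
    triNorm (d - NeckCoarse.triIdxPt R ℓ Nc S.a₀ (S.t i)) < (S.t j - S.t i + 1) * ℓ := by
  have hi : i < S.n := by omega
  have ht0 := S.t_nonneg hi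
  have ht1 := S.t_lt i hi
  have h := NeckCoarse.triNorm_sub_lt_of_rotIdx hℓ hR hNc hd (NeckCoarse.triNorm_triIdxPt hℓ hNc' S.a₀_nonneg S.a₀_lt ht0 ht1) (a₀ := S.a₀)
  rw [NeckCoarse.rotIdx_triCellIdx_triIdxPt hℓ hNc' S.a₀_nonneg S.a₀_lt ht0 ht1, hcell] at h
  have h1 := S.t_mono him (by omega)
  have h2 := S.t_mono hmj hj
  rw [abs_of_nonneg (by omega)] at h
  have h3 : (S.t m - S.t i + 1) * ℓ ≤ (S.t j - S.t i + 1) * ℓ := mul_le_mul_of_nonneg_right (by omega) hℓ.le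
  exact h.trans_le h3

/-- **Outer isolation**: a ring point whose rotated cell is `t m` with `m < i` or `j < m < n`, for a non-root
interval `[i, j]`, is at `𝕋`-distance `≥ (ℓ G - 2ℓ + 1) / 2` from the centre `idxPt (t i)`, `G = gapOutZ i j`. -/
theorem le_two_mul_triNorm_sub_center (hℓ : 0 < ℓ) (hR : 1 ≤ R) (hNc : 6 * R ≤ Nc * ℓ) (hNc' : (Nc - 1) * ℓ < 6 * R)
    {d : Site 2} (hd : triNorm d = R) {i j m : ℕ} (hij : i ≤ j) (hj : j ≤ S.n - 1) (hroot : ¬ (i = 0 ∧ j = S.n - 1))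
    (hm : m < S.n) (hout : m < i ∨ j < m) (hcell : rotIdx Nc S.a₀ (NeckCoarse.triCellIdx R ℓ d) = S.t m) :
    ℓ * S.gapOutZ Groot i j - 2 * ℓ + 1 ≤ 2 * triNorm (d - NeckCoarse.triIdxPt R ℓ Nc S.a₀ (S.t i)) := by
  have hi : i < S.n := by omega
  have ht0 := S.t_nonneg hi
  have ht1 := S.t_lt i hi
  have h := NeckCoarse.le_two_mul_triNorm_sub_of_rotIdx hℓ hR hNc hNc' hd
    (NeckCoarse.triNorm_triIdxPt hℓ hNc' S.a₀_nonneg S.a₀_lt ht0 ht1) (a₀ := S.a₀)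
  rw [NeckCoarse.rotIdx_triCellIdx_triIdxPt hℓ hNc' S.a₀_nonneg S.a₀_lt ht0 ht1, hcell] at h
  obtain ⟨-, hGwrap, hGl, hGr⟩ := S.gapOutZ_le Groot hij hj hroot
  set G := S.gapOutZ Groot i j
  -- `G ≤ Δ` and `G ≤ Nc - Δ`
  have hΔ : G ≤ |S.t m - S.t i| := by
    rcases hout with h' | h'
    · rw [abs_of_nonpos (by have := S.t_mono h'.le hi; omega)]
      have := hGl m h'
      omega
    · rw [abs_of_nonneg (by have := S.t_mono (hij.trans h'.le) hm; omega)]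
      exact hGr m h' hm
  have hΔ' : G ≤ Nc - |S.t m - S.t i| := by
    have h1 := S.t_nonneg hm
    have h2 := S.t_le_last hm
    have h3 := S.t_le_last hi
    have : |S.t m - S.t i| ≤ S.t (S.n - 1) := by
      rw [abs_le]
      constructor <;> omega
    omega
  have key : ℓ * G ≤ min (ℓ * |S.t m - S.t i|) (ℓ * (Nc - |S.t m - S.t i|)) :=
    le_min (mul_le_mul_of_nonneg_left hΔ hℓ.le) (mul_le_mul_of_nonneg_left hΔ' hℓ.le)
  omega

/-! ## §2 Existence of a cell skeleton for a finite set of hexagonal ring offsets -/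

/-- **Every nonempty finite set of ring offsets has a cell skeleton listing exactly its rotated cells.** -/
theorem exists_triCellSkeleton (hℓ : 0 < ℓ) (hR : 1 ≤ R) (hNc : 6 * R ≤ Nc * ℓ) (D : Finset (Site 2))
    (hne : D.Nonempty) (hD : ∀ d ∈ D, triNorm d = R) :
    ∃ S : CellSkeleton Nc, (∀ d ∈ D, ∃ m < S.n, rotIdx Nc S.a₀ (NeckCoarse.triCellIdx R ℓ d) = S.t m) ∧
      ∀ m < S.n, ∃ d ∈ D, rotIdx Nc S.a₀ (NeckCoarse.triCellIdx R ℓ d) = S.t m := by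
  classical
  -- the occupied cells and the good cut
  set C₀ := D.image (NeckCoarse.triCellIdx R ℓ) with hC₀
  have hC₀ne : C₀.Nonempty := hne.image _
  have hC₀r : ∀ C ∈ C₀, 0 ≤ C ∧ C < Nc := fun C hC ↦ by
    obtain ⟨d, hd, rfl⟩ := mem_image.1 hC
    exact ⟨NeckCoarse.triCellIdx_nonneg hℓ (hD d hd), NeckCoarse.triCellIdx_lt hℓ hR (hD d hd) hNc⟩
  obtain ⟨a₀, ha₀, hcut⟩ := exists_good_cut C₀ hC₀ne hC₀r
  obtain ⟨ha₀0, ha₀1⟩ := hC₀r a₀ ha₀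
  -- the sorted rotated cells
  set T := C₀.image (rotIdx Nc a₀) with hT
  have hTne : T.Nonempty := hC₀ne.image _
  set n := T.card with hn
  have hn1 : 1 ≤ n := hTne.card_pos
  set e : Fin n ↪o ℤ := T.orderEmbOfFin rfl with he
  set t : ℕ → ℤ := fun m ↦ if h : m < n then e ⟨m, h⟩ else 0 with htdef
  have ht : ∀ m (h : m < n), t m = e ⟨m, h⟩ := fun m h ↦ dif_pos h
  have hmemT : ∀ m (h : m < n), t m ∈ T := fun m h ↦ by rw [ht m h]; exact T.orderEmbOfFin_mem rfl _
  have hsurj : ∀ y ∈ T, ∃ m < n, t m = y := fun y hy ↦ by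
    have : y ∈ Set.range e := by rw [he, range_orderEmbOfFin]; exact hy
    obtain ⟨⟨m, hm⟩, rfl⟩ := this
    exact ⟨m, hm, ht m hm⟩
  have hTr : ∀ y ∈ T, 0 ≤ y ∧ y < Nc := fun y hy ↦ by
    obtain ⟨C, hC, rfl⟩ := mem_image.1 hy
    exact ⟨rotIdx_nonneg ha₀1 (hC₀r C hC).1, rotIdx_lt ha₀0 (hC₀r C hC).2⟩
  have hmono : ∀ m m' (h : m < n) (h' : m' < n), m < m' → t m < t m' := fun m m' h h' hmm ↦ by
    rw [ht m h, ht m' h']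
    exact e.strictMono (Fin.mk_lt_mk.2 hmm)
  -- `t 0 = 0`: the cut is occupied and `0` is the least value
  have h0T : (0 : ℤ) ∈ T := mem_image.2 ⟨a₀, ha₀, rotIdx_self⟩
  have ht0 : t 0 = 0 := by
    obtain ⟨m, hm, hm0⟩ := hsurj 0 h0T
    have h1 : 0 ≤ t 0 := (hTr _ (hmemT 0 (by omega))).1
    rcases Nat.eq_zero_or_pos m with rfl | hpos
    · exact hm0
    · have := hmono 0 m (by omega) hm hpos
      omega
  -- the wrap property from the good cut
  have hwrap : ∀ m, m + 1 < n → t (m + 1) - t m ≤ Nc - t (n - 1) := by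
    intro m hm
    obtain ⟨u, hu, hut⟩ := mem_image.1 (hmemT m (by omega))
    obtain ⟨v, hv, hvt⟩ := mem_image.1 (hmemT (m + 1) hm)
    obtain ⟨w, hw, hwt⟩ := mem_image.1 (hmemT (n - 1) (by omega))
    have h := hcut u hu v hv (by rw [hut, hvt]; exact hmono m (m + 1) (by omega) hm m.lt_succ_self)
      (fun z hz ↦ by
        obtain ⟨m', hm', hm't⟩ := hsurj _ (mem_image_of_mem _ hz)
        rw [hut, hvt, ← hm't]
        rcases le_or_gt m' m with hle | hlt
        · left
          rcases hle.eq_or_lt with rfl | hlt'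
          · exact le_rfl
          · exact (hmono m' m hm' (by omega) hlt').le
        · right
          rcases (Nat.succ_le_of_lt hlt).eq_or_lt with h' | h'
          · rw [show m' = m + 1 by omega]
          · exact (hmono (m + 1) m' hm hm' h').le) w hw
    rwa [hut, hvt, hwt] at h
  refine ⟨⟨a₀, n, t, ha₀0, ha₀1, hn1, ht0, fun m hm ↦ hmono m (m + 1) (by omega) hm m.lt_succ_self,
    fun m hm ↦ (hTr _ (hmemT m hm)).2, hwrap⟩, fun d hd ↦ ?_, fun m hm ↦ ?_⟩
  · obtain ⟨m, hm, hmt⟩ := hsurj _ (mem_image_of_mem _ (mem_image_of_mem _ hd))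
    exact ⟨m, hm, hmt.symm⟩
  · obtain ⟨C, hC, hCt⟩ := mem_image.1 (hmemT m hm)
    obtain ⟨d, hd, rfl⟩ := mem_image.1 hC
    exact ⟨d, hd, hCt⟩


end CellSkeleton

end NeckCoarseZ2

/-- **Isolation of hierarchy nodes on a cell skeleton of the hexagonal ring (registered helper, anchor of this module on the
crux item).**  For a cell skeleton `S` (`(Nc - 1) ℓ < 6R ≤ Nc ℓ`, `ℓ ≥ 1`, `R ≥ 1`), an index interval `i ≤ j < n` with centre
`triIdxPt (t i)`, and a ring point `d` of rotated cell `t m`: if `i ≤ m ≤ j` then `|d - centre|_𝕋 < (t j - t i + 1) ℓ`; if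
`m < i` or `j < m` and `[i, j]` is not the root then `ℓ · gapOutZ i j - 2ℓ + 1 ≤ 2 |d - centre|_𝕋`. -/
theorem triCellSkeleton_isolation : ∀ (R ℓ Nc Groot : ℤ) (S : NeckCoarseZ2.CellSkeleton Nc) (d : Site 2) (i j m : ℕ), 0 < ℓ → 1 ≤ R → 6 * R ≤ Nc * ℓ → (Nc - 1) * ℓ < 6 * R → triNorm d = R → NeckCoarseZ2.rotIdx Nc S.a₀ (NeckCoarse.triCellIdx R ℓ d) = S.t m → m < S.n → i ≤ j → j < S.n → ((i ≤ m ∧ m ≤ j) → triNorm (d - NeckCoarse.triIdxPt R ℓ Nc S.a₀ (S.t i)) < (S.t j - S.t i + 1) * ℓ) ∧ ((m < i ∨ j < m) → ¬ (i = 0 ∧ j = S.n - 1) → ℓ * S.gapOutZ Groot i j - 2 * ℓ + 1 ≤ 2 * triNorm (d - NeckCoarse.triIdxPt R ℓ Nc S.a₀ (S.t i))) :=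
  fun _ _ _ Groot S _ _ _ _ hℓ hR hNc hNc' hd hcell hm hij hj ↦
    ⟨fun h ↦ S.triNorm_sub_center_lt hℓ hR hNc hNc' hd h.1 h.2 hj hcell,
      fun h hroot ↦ S.le_two_mul_triNorm_sub_center Groot hℓ hR hNc hNc' hd hij (by omega) hroot hm h hcell⟩

end Summit.CriticalPhenomena.CardyFormulaZ2.Cruxes.NestingRigidity.PinchResampling

end
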